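import Summits.ABC.IUTFork.Cor312PinnedRegionsThreePins
import Summits.ABC.IUTFork.Cor312PilotKummerCompat
import Summits.ABC.IUTFork.Cor312ProvenanceGenuine
import Summits.ABC.IUTFork.Cor312PilotIdelesPrCapstone
import Summits.ABC.IUTFork.Thm311Real3
import Summits.ABC.ABC.Theorems.IUTThetaPilotThetaPartIIOfChildren
import Summits.ABC.ABC.Theorems.IUTThetaPilotGenEllTwo
import HarnessLib

/-!
# Branch C certificate AT THE GENUINE SETTING — `abc_of_S_v3` (hull-level line S_H), `cor312Of_of_SH_genuine`, `cor312Of_of_S_genuine`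

C scoreboard v3 (`abc_of_S_v3`): apex explicit 2 (S_H-bundle `H` · CONE `hvol`) / EFFECTIVE 2; per datum (`cor312Of_of_SH_genuine`): S_H 1 · PIN 1 (+ idele side 5) · FACT 0 · CONE 0 · READ 4 = 11 named
EFFECTIVE Prop hypotheses: explicit 15 + transitive structure fields 66 = 81 [FACT-LIST 1 · SUMMIT-PROP 0 · LITERATURE-PROP 5 · CORE 45 · COMPOUND 15 · other 0 · nested structures 5] (v3: fields of project-structure DATA binders, depth ≤ 4, a nested structure type is expanded once per binder)
(line 3 = abc-iut-w5-d035 `HypAuditScan.lean` (HOME/staging/L6/w5-d035, sha16 ee44984fb8405dff at run time) VERBATIM for `cor312Of_of_SH_genuine`: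
15 = 11 named + 4 instance-class Props (`NumberField F/K/M`, `E.IsElliptic`); the 66 structure-field Props are the genuine Θ-data
`D : InitialThetaData` ([IUTchI] Def. 3.1 (a)–(f) as fields, incl. the `π₁`-interface), `I`, `X`, `lat`, `sig`, `split`, `qData` — all of them
THEOREMS at the apex, where `D := T.D` of the PROVED-to-exist datum (`ThetaPartII.stub_thetaData`); for `abc_of_S_v3` the tool reads 2 / 2.)

Companion of `Conditional/AbcOfS.lean` (v0 `abc_of_S` p427180 · v1 `abc_of_S_v1` p428085 · v2 `abc_of_S_v2` p428991, explicit 7 / EFFECTIVE 26, where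
the Cor.-3.12 setting `P312 P l T` is FREE data tied to the genuine Θ-datum only by the two number identifications `hΘ`, `hq`); filed as a
separate module because `AbcOfS.lean` is at 290/400 lines. Writer abc-iut-C-cert-2 (odd revisions; keeper of HOME/plan/conditional/HYPS.tsv).
REVISION v3 (C-lead C-R3 / `AbcOfS.lean` v2 item (5) «intended discharge at c312-7's assembled real setting … at which point F, P312 stop
being free data»): the setting IS abc-iut-c312-7's PRINT-NORMALISED ASSEMBLED REAL SETTING `Thm311.Real.settingPrVolSharp` (real log-shells of
the datum's field `F` with the analytic logarithm `analyticLogv F`, packet-normalised volumes, Dupuy–Hilado pilot regions read off ideles) over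
abc-iut-c312-5's `Thm311.LatticeSituation.ofShells`. THERE: `BridgeHyps` and `ThetaFinite` are THEOREMS (`bridgeHyps_settingPrVolSharp_of_ideles`),
the provenance `Cor312Prov.IsSettingOf D P` is a THEOREM (index from `IsPilotDataOf`, the `q`-number «`|log(q)| = (1/2l)·log(q)`» =
`negLogQ_settingPrVolSharp_eq_neg_absLogq`) — so v2's `hBridge` and `hq` are DISCHARGED. TWO per-datum certificates are recorded:
* `cor312Of_of_S_genuine` — the S-form (S = `PilotKummerIndRelated`, two pins, Thm. 3.11 (ii)(b) at column `n`). FOR THE RECORD ONLY: S is an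
  IDENTIFICATION-level reading and is REFUTED wherever the indeterminacies preserve admissibility/log-volume and one packet has
  `vol(q-region) ≠ vol(Θ-region)` (abc-iut-w5-d155 `not_pilotKummerIndRelated_of_qLocal_ne`, abc-iut-w4-d103 `Cor312PinnedRegionsHonest`;
  at this very setting with REALISING Θ-ideles: abc-iut-C-cert-1, pending) — so with honestly scaled Θ-ideles its antecedent is not satisfiable;
* `cor312Of_of_SH_genuine` — the HULL-LEVEL form S_H = abc-iut-w5-d068's `PilotKummerCompatHull` (the SAME printed clause, [IUTchIII] Thm. 3.11
  (iii)(c) final clause / Cor. 3.12 Step (xi-d) «followed by formation of the holomorphic hull»; under the q-pin = c312-1's (xi-f) `Licence`),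
  with the q-PIN ALONE; `S ⟹ S_H` given the pins, so this is the STRONGER theorem, its hypothesis is NOT refuted by volumes, and Theorem 3.11 is
  NOT an input on this line — THIS is v3's line, composed into `abc_of_S_v3` with the route's child (ii′) `hvol` and, BY NAME, abc-iut-S2
  `ABC_of_cor312_of_hullVolume_of_genEllTwo` + abc-iut-S6 `genEllTwo_holds` ([GenEll] Thm 2.1 at `Σ = {2}` PROVED).
HONEST FRAMING: this campaign LOCATES / CONDITIONALLY VERIFIES. Nothing here asserts that abc is proved or refuted, or that [IUTchIII] Cor. 3.12
holds or fails at any datum, or takes a side on any author (Mochizuki / Scholze–Stix / Joshi / Dupuy–Hilado); statements about OUR typed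
objects; «`ABC` follows from S_H + the listed hypotheses AS TYPED», nothing more; typed ≠ proved. [claim: Mochizuki2012, status: disputed]
-/

noncomputable section

namespace Summit.ABC.IUTFork.Conditional

open Thm311 Thm311.Real Cor312 Cor312Vol Cor312Prov
open Literature.IUT.LogThetaLattice Literature.IUT.LogVolume Literature.IUT.HodgeTheaters
open Literature.NumberTheory.DiophantineGeometry.GenEll NumberField IsDedekindDomain

/-- **Per-datum certificate at the GENUINE setting, S-form (FOR THE RECORD; see the module docstring: with honestly scaled Θ-ideles its
antecedent is refutable).** Genuine Θ-data `D` with volume input `I` and pilot data `X` OF `D`; the setting = abc-iut-c312-7's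
`Real.settingPrVolSharp` over abc-iut-c312-5's `LatticeSituation.ofShells` (free column binders). `BridgeHyps`, `ThetaFinite`, `IsSettingOf` are
THEOREMS there; remaining: [S] `hS`; [PIN] `hPin` (two pins) + idele side conditions `htq0/htq1/htq/ht0/ht1`; [CONE] `hKumB` (Thm. 3.11 (ii)(b)
at column `n`); [READ] `hI`, `hX`, `hplaces`, `hΘ` (ONE-SIDED Θ-identification, C312-RESIDUALS §1a′) ⟹ `I.Cor312Of`. Route: PR-1 R3 bridge ⟹
`Statement` ⟹ c312-8 `cor312Of_of_statement_of_links`. [claim: Mochizuki2012, status: disputed] -/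
theorem cor312Of_of_S_genuine
    -- the genuine Θ-data and its volume input
    {F K Fbar : Type} [Field F] [NumberField F] [Field K] [NumberField K] [Algebra F K] [Field Fbar] [Algebra F Fbar]
    [Algebra K Fbar] {E : WeierstrassCurve F} [E.IsElliptic] {l : ℕ} {Pb : BadPlacePredicates K}
    (D : InitialThetaData F K Fbar E l Pb) (I : ThetaVolumeInput (fieldOfModuli E) K)
    -- Dupuy–Hilado pilot data over F and the data of the print-normalised assembled real setting (abc-iut-c312-7's binders)
    (X : PilotData F) (M : Type) [Field M] [NumberField M]
    (archPk : ∀ (j : (thetaIndex X).Label) (vQ : (thetaIndex X).VQ), Set ((logShellsDH X (analyticLogv F)).Packet j vQ))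
    (archSub : ∀ (j : (thetaIndex X).Label) (v : (thetaIndex X).V),
      Set ((logShellsDH X (analyticLogv F)).Packet j ((thetaIndex X).over v)))
    (Ψ : ℤ → ∀ v : (thetaIndex X).V, v ∈ (thetaIndex X).Vbad → Set ((logShellsDH X (analyticLogv F)).StarPacket v))
    (act : ℤ → ∀ v : (thetaIndex X).V, v ∈ (thetaIndex X).Vbad →
      (logShellsDH X (analyticLogv F)).StarPacket v → Module.End ℚ ((logShellsDH X (analyticLogv F)).StarPacket v))
    (Mmod : ℤ → ∀ j : (thetaIndex X).LabelStar, Set ((logShellsDH X (analyticLogv F)).GlobalPacket j.1))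
    (region : ℤ → ∀ j : (thetaIndex X).LabelStar, FinDivisor M → ∀ vQ : (thetaIndex X).VQ,
      Set ((logShellsDH X (analyticLogv F)).Packet j.1 vQ))
    -- the Frobenius-like column binders of abc-iut-c312-5's `LatticeSituation.ofShells`
    (frobAdm : ℤ → ℤ → ∀ (j : (thetaIndex X).Label) (vQ : (thetaIndex X).VQ),
      Set ((logShellsDH X (analyticLogv F)).Packet j vQ) → Prop)
    (frobLogvol : ℤ → ℤ → ∀ (j : (thetaIndex X).Label) (vQ : (thetaIndex X).VQ),
      Set ((logShellsDH X (analyticLogv F)).Packet j vQ) → ℝ)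
    (frobΨ : ℤ → ℤ → ∀ v : (thetaIndex X).V, v ∈ (thetaIndex X).Vbad → Set ((logShellsDH X (analyticLogv F)).StarPacket v))
    (frobMmod : ℤ → ℤ → ∀ j : (thetaIndex X).LabelStar, Set ((logShellsDH X (analyticLogv F)).GlobalPacket j.1))
    (unitImage : ℤ → ℤ → ℕ → ∀ (j : (thetaIndex X).Label) (vQ : (thetaIndex X).VQ),
      Set ((logShellsDH X (analyticLogv F)).Packet j vQ))
    (ballImage : ℤ → ℤ → ∀ (j : (thetaIndex X).Label) (vQ : (thetaIndex X).VQ),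
      Set ((logShellsDH X (analyticLogv F)).Packet j vQ))
    (thetaDiv : ℤ → ℤ → LgpDivisor M (thetaIndex X).lstar)
    (n : ℤ) {HT : Type} {LogLink : HT → HT → Type} {IsFull : ∀ {s t : HT}, LogLink s t → Prop}
    (lat : LGPGaussianLogThetaLattice LogLink IsFull)
    {Frd : Type} {IsoF : Frd → Frd → Type} {Ob : Frd → Type} {realify : Frd → Frd} {Strip : Type}
    {IsoS : Strip → Strip → Type} {Mv : ∀ v : (thetaIndex X).V, v ∈ (thetaIndex X).Vbad → Type}
    [∀ v h, Monoid (Mv v h)]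
    (sig : GlobalLGPFrobenioidSignature (thetaIndex X).lstar (thetaIndex X).V (· ∈ (thetaIndex X).Vbad)
      Frd IsoF Ob realify Strip IsoS Mv)
    (split : SplittingMonoids Mv) {ObΔ : Type} {N : ∀ v : (thetaIndex X).V, v ∈ (thetaIndex X).Vbad → Type}
    [∀ v h, Monoid (N v h)] (qData : QPilotData ObΔ N)
    -- the ideles: q-pilot `tq` and Θ-pilot `t`
    (tq : ∀ (pp : Nat.Primes) (x : (thetaIndex X).Fibre (.inr pp)), haveI : Fact (pp : ℕ).Prime := ⟨pp.2⟩; kOf X pp.1 x)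
    (t : ∀ (pp : Nat.Primes) (_ : Fin X.lstar) (x : (thetaIndex X).Fibre (.inr pp)),
      haveI : Fact (pp : ℕ).Prime := ⟨pp.2⟩; kOf X pp.1 x)
    -- PR-1's region reading and q-pilot Kummer datum on the real star packets
    (ρ : (∀ v : (thetaIndex X).V, v ∈ (thetaIndex X).Vbad → Set ((logShellsDH X (analyticLogv F)).StarPacket v)) →
      ∀ (j : (thetaIndex X).Label) (vQ : (thetaIndex X).VQ), Set ((logShellsDH X (analyticLogv F)).Packet j vQ))
    (qK : ∀ v : (thetaIndex X).V, v ∈ (thetaIndex X).Vbad → Set ((logShellsDH X (analyticLogv F)).StarPacket v))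
    -- [PIN-side] idele side conditions (non-zero; units off S; `tq` realises P_q in Dupuy–Hilado's normalisation (3.4))
    (htq0 : ∀ pp x, tq pp x ≠ 0)
    (htq1 : ∀ (pp : Nat.Primes) (x : (thetaIndex X).Fibre (.inr pp)),
      haveI : Fact (pp : ℕ).Prime := ⟨pp.2⟩; placeOf X pp.1 x ∉ X.S → ‖tq pp x‖ = 1)
    (htq : ∀ (pp : Nat.Primes) (x : (thetaIndex X).Fibre (.inr pp)),
      haveI : Fact (pp : ℕ).Prime := ⟨pp.2⟩
      Real.log ‖tq pp x‖ = -(X.qPilot (placeOf X pp.1 x)) * logNorm F (placeOf X pp.1 x) /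
        localDegree F (placeOf X pp.1 x))
    (ht0 : ∀ pp i x, t pp i x ≠ 0)
    (ht1 : ∀ (pp : Nat.Primes) (i : Fin X.lstar) (x : (thetaIndex X).Fibre (.inr pp)),
      haveI : Fact (pp : ℕ).Prime := ⟨pp.2⟩; placeOf X pp.1 x ∉ X.S → ‖t pp i x‖ = 1)
    -- [READ] provenance: `I` is a volume input OF `D`, `X` is the pilot data OF `D`, the index bijection
    (hI : ThetaData.IsVolumeInputOf D I) (hX : IsPilotDataOf D X)
    (hplaces : ∃ e : (thetaIndex X).V ≃ D.V, ∀ v : (thetaIndex X).V,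
      v ∈ (thetaIndex X).Vbad ↔ ((e v : D.V) : Val K) ∈ D.Vbad)
    -- [S] at the genuine setting
    (hS : Cor312Vol.PilotKummerIndRelated
      (LatticeSituation.ofShells (logShellsDH X (analyticLogv F)) M archPk archSub
        (summandPiecesPr X (logvAnalytic_analyticLogv (F := F))).Adm
        (summandPiecesPr X (logvAnalytic_analyticLogv (F := F))).logvol Ψ act Mmod region
        frobAdm frobLogvol frobΨ frobMmod unitImage ballImage thetaDiv)
      (settingPrVolSharp X (logvAnalytic_analyticLogv (F := F)) M archPk archSub Ψ act Mmod region n lat sig split qData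
        tq t htq0 htq1) ρ qK)
    -- [PIN] the two region pins at the genuine setting
    (hPin : Cor312Vol.PinnedRegions
      (LatticeSituation.ofShells (logShellsDH X (analyticLogv F)) M archPk archSub
        (summandPiecesPr X (logvAnalytic_analyticLogv (F := F))).Adm
        (summandPiecesPr X (logvAnalytic_analyticLogv (F := F))).logvol Ψ act Mmod region
        frobAdm frobLogvol frobΨ frobMmod unitImage ballImage thetaDiv)
      (settingPrVolSharp X (logvAnalytic_analyticLogv (F := F)) M archPk archSub Ψ act Mmod region n lat sig split qData
        tq t htq0 htq1) ρ qK)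
    -- [CONE] Thm. 3.11 (ii)(b) at column n, on the free column binder `frobΨ`
    (hKumB : ((LatticeSituation.ofShells (logShellsDH X (analyticLogv F)) M archPk archSub
        (summandPiecesPr X (logvAnalytic_analyticLogv (F := F))).Adm
        (summandPiecesPr X (logvAnalytic_analyticLogv (F := F))).logvol Ψ act Mmod region
        frobAdm frobLogvol frobΨ frobMmod unitImage ballImage thetaDiv).col n).KummerB
      ((LatticeSituation.ofShells (logShellsDH X (analyticLogv F)) M archPk archSub
        (summandPiecesPr X (logvAnalytic_analyticLogv (F := F))).Adm
        (summandPiecesPr X (logvAnalytic_analyticLogv (F := F))).logvol Ψ act Mmod region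
        frobAdm frobLogvol frobΨ frobMmod unitImage ballImage thetaDiv).D n))
    -- [READ] the one-sided Θ-identification (OPEN, C312-RESIDUALS §1a′)
    (hΘ : (settingPrVolSharp X (logvAnalytic_analyticLogv (F := F)) M archPk archSub Ψ act Mmod region n lat sig split qData
        tq t htq0 htq1).negLogTheta ≤ ((I.negLogTheta : ℝ) : WithTop ℝ)) :
    I.Cor312Of := by
  -- provenance `IsSettingOf D P` at the genuine setting (= abc-iut-c312-7 `isSettingOf_settingPrVolSharp`, restated field by field so
  -- that only BUILT modules are imported): label count from `IsPilotDataOf.l_eq`, places = `hplaces`, `𝕍(F)^bad` finite (c312-8),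
  -- the q-number identity = c312-7 `negLogQ_settingPrVolSharp_eq_neg_absLogq` (THEOREM)
  have hSet : IsSettingOf D (settingPrVolSharp X (logvAnalytic_analyticLogv (F := F)) M archPk archSub Ψ act Mmod region n lat
      sig split qData tq t htq0 htq1) :=
    { lstar_eq := by show X.lstar = (l - 1) / 2; rw [PilotData.lstar, hX.l_eq]
      places := hplaces
      VFbad_finite := vFbad_finite D
      negLogQ_eq := negLogQ_settingPrVolSharp_eq_neg_absLogq X (logvAnalytic_analyticLogv (F := F)) M archPk archSub Ψ act
        Mmod region n lat sig split qData t tq hX htq0 htq1 htq }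
  have hBr := bridgeHyps_settingPrVolSharp_of_ideles X (logvAnalytic_analyticLogv (F := F)) M archPk archSub Ψ act Mmod region
    n lat sig split qData t tq ht0 ht1 htq0 htq1
  -- READING R3 at every packet from S + two pins + (ii)(b) (PR-1), then the printed Statement (c312-6 R3 bridge, `BridgeHyps` a theorem here)
  have h3 := (Cor312Vol.reading3_iff_pilotKummerIndRelated
    (LatticeSituation.ofShells (logShellsDH X (analyticLogv F)) M archPk archSub
      (summandPiecesPr X (logvAnalytic_analyticLogv (F := F))).Adm
      (summandPiecesPr X (logvAnalytic_analyticLogv (F := F))).logvol Ψ act Mmod region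
      frobAdm frobLogvol frobΨ frobMmod unitImage ballImage thetaDiv)
    (settingPrVolSharp X (logvAnalytic_analyticLogv (F := F)) M archPk archSub Ψ act Mmod region n lat sig split qData
      tq t htq0 htq1) ρ qK hKumB hPin).2 hS
  have hst : (settingPrVolSharp X (logvAnalytic_analyticLogv (F := F)) M archPk archSub Ψ act Mmod region n lat sig split qData
      tq t htq0 htq1).Statement :=
    Cor312Vol.statement_of_qRegion_mem_possibleImages hBr fun i vQ => h3 (Cor312.Setting.labelSucc i) vQ
  exact cor312Of_of_statement_of_links D hI hSet hΘ hst

/-- **Per-datum certificate at the GENUINE setting, HULL-LEVEL form S_H (v3's line).** Same genuine data as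
`cor312Of_of_S_genuine`; the hypothesis is the WEAKEST typed form of the printed Kummer/link-compatibility clause — abc-iut-w5-d068's
`Cor312Vol.PilotKummerCompatHull` («in every packet the `ρ`-region of the q-pilot's Kummer datum lies in the holomorphic hull of the union
of the possible images of the Θ-pilot», [IUTchIII] Cor. 3.12 Step (xi-d) p. 183 l. 2–8 «followed by formation of the holomorphic hull»;
under the q-pin it IS abc-iut-c312-1's (xi-f) `Licence`, `licence_of_pilotKummerCompatHull`) — together with the q-PIN ALONE. `S ⟹ S_H` given
the pins and (ii)(b) (`pilotKummerCompatHull_of_region` ∘ `pilotKummerCompatRegion_iff_pilotKummerIndRelated`), so this is a STRONGER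
theorem than the S-form; and unlike S (an identification-level reading, refuted wherever the indeterminacies preserve admissibility and
log-volume and `|log(q)| > 0`: abc-iut-w5-d155 `not_pilotKummerIndRelated_of_qLocal_ne`, abc-iut-w4-d103 `Cor312PinnedRegionsHonest`) the
hull-level clause is NOT refuted by volumes — at the genuine setting it is exactly the disputed (xi-f) inclusion. Theorem 3.11 is NOT
an input on this line (`statement_of_pilotKummerCompatHull`: `BridgeHyps` (a theorem here) + q-pin + S_H ⟹ `Statement`). Remaining named
Props: [S_H] `hSH`; [PIN] `hQPin` + the idele side conditions; [READ] `hI`, `hX`, `hplaces`, `hΘ` (one-sided; genuineness of the Θ-side: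
Θ-ideles `t` with too large boxes make `hSH` cheap but violate `hΘ`). [claim: Mochizuki2012, status: disputed] -/
theorem cor312Of_of_SH_genuine
    -- the genuine Θ-data and its volume input
    {F K Fbar : Type} [Field F] [NumberField F] [Field K] [NumberField K] [Algebra F K] [Field Fbar] [Algebra F Fbar]
    [Algebra K Fbar] {E : WeierstrassCurve F} [E.IsElliptic] {l : ℕ} {Pb : BadPlacePredicates K}
    (D : InitialThetaData F K Fbar E l Pb) (I : ThetaVolumeInput (fieldOfModuli E) K)
    -- Dupuy–Hilado pilot data over F and the data of the print-normalised assembled real setting (abc-iut-c312-7's binders)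
    (X : PilotData F) (M : Type) [Field M] [NumberField M]
    (archPk : ∀ (j : (thetaIndex X).Label) (vQ : (thetaIndex X).VQ), Set ((logShellsDH X (analyticLogv F)).Packet j vQ))
    (archSub : ∀ (j : (thetaIndex X).Label) (v : (thetaIndex X).V),
      Set ((logShellsDH X (analyticLogv F)).Packet j ((thetaIndex X).over v)))
    (Ψ : ℤ → ∀ v : (thetaIndex X).V, v ∈ (thetaIndex X).Vbad → Set ((logShellsDH X (analyticLogv F)).StarPacket v))
    (act : ℤ → ∀ v : (thetaIndex X).V, v ∈ (thetaIndex X).Vbad →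
      (logShellsDH X (analyticLogv F)).StarPacket v → Module.End ℚ ((logShellsDH X (analyticLogv F)).StarPacket v))
    (Mmod : ℤ → ∀ j : (thetaIndex X).LabelStar, Set ((logShellsDH X (analyticLogv F)).GlobalPacket j.1))
    (region : ℤ → ∀ j : (thetaIndex X).LabelStar, FinDivisor M → ∀ vQ : (thetaIndex X).VQ,
      Set ((logShellsDH X (analyticLogv F)).Packet j.1 vQ))
    -- the Frobenius-like column binders of abc-iut-c312-5's `LatticeSituation.ofShells`
    (frobAdm : ℤ → ℤ → ∀ (j : (thetaIndex X).Label) (vQ : (thetaIndex X).VQ),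
      Set ((logShellsDH X (analyticLogv F)).Packet j vQ) → Prop)
    (frobLogvol : ℤ → ℤ → ∀ (j : (thetaIndex X).Label) (vQ : (thetaIndex X).VQ),
      Set ((logShellsDH X (analyticLogv F)).Packet j vQ) → ℝ)
    (frobΨ : ℤ → ℤ → ∀ v : (thetaIndex X).V, v ∈ (thetaIndex X).Vbad → Set ((logShellsDH X (analyticLogv F)).StarPacket v))
    (frobMmod : ℤ → ℤ → ∀ j : (thetaIndex X).LabelStar, Set ((logShellsDH X (analyticLogv F)).GlobalPacket j.1))
    (unitImage : ℤ → ℤ → ℕ → ∀ (j : (thetaIndex X).Label) (vQ : (thetaIndex X).VQ),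
      Set ((logShellsDH X (analyticLogv F)).Packet j vQ))
    (ballImage : ℤ → ℤ → ∀ (j : (thetaIndex X).Label) (vQ : (thetaIndex X).VQ),
      Set ((logShellsDH X (analyticLogv F)).Packet j vQ))
    (thetaDiv : ℤ → ℤ → LgpDivisor M (thetaIndex X).lstar)
    (n : ℤ) {HT : Type} {LogLink : HT → HT → Type} {IsFull : ∀ {s t : HT}, LogLink s t → Prop}
    (lat : LGPGaussianLogThetaLattice LogLink IsFull)
    {Frd : Type} {IsoF : Frd → Frd → Type} {Ob : Frd → Type} {realify : Frd → Frd} {Strip : Type}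
    {IsoS : Strip → Strip → Type} {Mv : ∀ v : (thetaIndex X).V, v ∈ (thetaIndex X).Vbad → Type}
    [∀ v h, Monoid (Mv v h)]
    (sig : GlobalLGPFrobenioidSignature (thetaIndex X).lstar (thetaIndex X).V (· ∈ (thetaIndex X).Vbad)
      Frd IsoF Ob realify Strip IsoS Mv)
    (split : SplittingMonoids Mv) {ObΔ : Type} {N : ∀ v : (thetaIndex X).V, v ∈ (thetaIndex X).Vbad → Type}
    [∀ v h, Monoid (N v h)] (qData : QPilotData ObΔ N)
    -- the ideles: q-pilot `tq` and Θ-pilot `t`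
    (tq : ∀ (pp : Nat.Primes) (x : (thetaIndex X).Fibre (.inr pp)), haveI : Fact (pp : ℕ).Prime := ⟨pp.2⟩; kOf X pp.1 x)
    (t : ∀ (pp : Nat.Primes) (_ : Fin X.lstar) (x : (thetaIndex X).Fibre (.inr pp)),
      haveI : Fact (pp : ℕ).Prime := ⟨pp.2⟩; kOf X pp.1 x)
    -- PR-1's region reading and q-pilot Kummer datum on the real star packets
    (ρ : (∀ v : (thetaIndex X).V, v ∈ (thetaIndex X).Vbad → Set ((logShellsDH X (analyticLogv F)).StarPacket v)) →
      ∀ (j : (thetaIndex X).Label) (vQ : (thetaIndex X).VQ), Set ((logShellsDH X (analyticLogv F)).Packet j vQ))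
    (qK : ∀ v : (thetaIndex X).V, v ∈ (thetaIndex X).Vbad → Set ((logShellsDH X (analyticLogv F)).StarPacket v))
    -- [PIN-side] idele side conditions (non-zero; units off S; `tq` realises P_q in Dupuy–Hilado's normalisation (3.4))
    (htq0 : ∀ pp x, tq pp x ≠ 0)
    (htq1 : ∀ (pp : Nat.Primes) (x : (thetaIndex X).Fibre (.inr pp)),
      haveI : Fact (pp : ℕ).Prime := ⟨pp.2⟩; placeOf X pp.1 x ∉ X.S → ‖tq pp x‖ = 1)
    (htq : ∀ (pp : Nat.Primes) (x : (thetaIndex X).Fibre (.inr pp)),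
      haveI : Fact (pp : ℕ).Prime := ⟨pp.2⟩
      Real.log ‖tq pp x‖ = -(X.qPilot (placeOf X pp.1 x)) * logNorm F (placeOf X pp.1 x) /
        localDegree F (placeOf X pp.1 x))
    (ht0 : ∀ pp i x, t pp i x ≠ 0)
    (ht1 : ∀ (pp : Nat.Primes) (i : Fin X.lstar) (x : (thetaIndex X).Fibre (.inr pp)),
      haveI : Fact (pp : ℕ).Prime := ⟨pp.2⟩; placeOf X pp.1 x ∉ X.S → ‖t pp i x‖ = 1)
    -- [READ] provenance: `I` is a volume input OF `D`, `X` is the pilot data OF `D`, the index bijection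
    (hI : ThetaData.IsVolumeInputOf D I) (hX : IsPilotDataOf D X)
    (hplaces : ∃ e : (thetaIndex X).V ≃ D.V, ∀ v : (thetaIndex X).V,
      v ∈ (thetaIndex X).Vbad ↔ ((e v : D.V) : Val K) ∈ D.Vbad)
    -- [S_H] the HULL-LEVEL printed clause at the genuine setting: the ρ-region of the q-pilot's Kummer datum lies in the Θ-hull
    (hSH : Cor312Vol.PilotKummerCompatHull
      (LatticeSituation.ofShells (logShellsDH X (analyticLogv F)) M archPk archSub
        (summandPiecesPr X (logvAnalytic_analyticLogv (F := F))).Adm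
        (summandPiecesPr X (logvAnalytic_analyticLogv (F := F))).logvol Ψ act Mmod region
        frobAdm frobLogvol frobΨ frobMmod unitImage ballImage thetaDiv)
      (settingPrVolSharp X (logvAnalytic_analyticLogv (F := F)) M archPk archSub Ψ act Mmod region n lat sig split qData
        tq t htq0 htq1) ρ qK)
    -- [PIN] the q-pin ALONE at the genuine setting
    (hQPin : Cor312Vol.QPinned
      (LatticeSituation.ofShells (logShellsDH X (analyticLogv F)) M archPk archSub
        (summandPiecesPr X (logvAnalytic_analyticLogv (F := F))).Adm
        (summandPiecesPr X (logvAnalytic_analyticLogv (F := F))).logvol Ψ act Mmod region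
        frobAdm frobLogvol frobΨ frobMmod unitImage ballImage thetaDiv)
      (settingPrVolSharp X (logvAnalytic_analyticLogv (F := F)) M archPk archSub Ψ act Mmod region n lat sig split qData
        tq t htq0 htq1) ρ qK)
    -- [READ] the one-sided Θ-identification (OPEN, C312-RESIDUALS §1a′)
    (hΘ : (settingPrVolSharp X (logvAnalytic_analyticLogv (F := F)) M archPk archSub Ψ act Mmod region n lat sig split qData
        tq t htq0 htq1).negLogTheta ≤ ((I.negLogTheta : ℝ) : WithTop ℝ)) :
    I.Cor312Of := by
  -- provenance `IsSettingOf D P` at the genuine setting (= abc-iut-c312-7 `isSettingOf_settingPrVolSharp`, restated field by field so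
  -- that only BUILT modules are imported): label count from `IsPilotDataOf.l_eq`, places = `hplaces`, `𝕍(F)^bad` finite (c312-8),
  -- the q-number identity = c312-7 `negLogQ_settingPrVolSharp_eq_neg_absLogq` (THEOREM)
  have hSet : IsSettingOf D (settingPrVolSharp X (logvAnalytic_analyticLogv (F := F)) M archPk archSub Ψ act Mmod region n lat
      sig split qData tq t htq0 htq1) :=
    { lstar_eq := by show X.lstar = (l - 1) / 2; rw [PilotData.lstar, hX.l_eq]
      places := hplaces
      VFbad_finite := vFbad_finite D
      negLogQ_eq := negLogQ_settingPrVolSharp_eq_neg_absLogq X (logvAnalytic_analyticLogv (F := F)) M archPk archSub Ψ act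
        Mmod region n lat sig split qData t tq hX htq0 htq1 htq }
  have hBr := bridgeHyps_settingPrVolSharp_of_ideles X (logvAnalytic_analyticLogv (F := F)) M archPk archSub Ψ act Mmod region
    n lat sig split qData t tq ht0 ht1 htq0 htq1
  -- the printed Statement from BridgeHyps (a theorem here) + the q-pin + the hull-level clause (abc-iut-w5-d068's weakest form;
  -- Theorem 3.11 is NOT consumed on this line)
  have hst : (settingPrVolSharp X (logvAnalytic_analyticLogv (F := F)) M archPk archSub Ψ act Mmod region n lat sig split qData
      tq t htq0 htq1).Statement :=
    Cor312Vol.statement_of_pilotKummerCompatHull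
      (LatticeSituation.ofShells (logShellsDH X (analyticLogv F)) M archPk archSub
        (summandPiecesPr X (logvAnalytic_analyticLogv (F := F))).Adm
        (summandPiecesPr X (logvAnalytic_analyticLogv (F := F))).logvol Ψ act Mmod region
        frobAdm frobLogvol frobΨ frobMmod unitImage ballImage thetaDiv)
      (settingPrVolSharp X (logvAnalytic_analyticLogv (F := F)) M archPk archSub Ψ act Mmod region n lat sig split qData
        tq t htq0 htq1) ρ qK hBr hQPin hSH
  exact cor312Of_of_statement_of_links D hI hSet hΘ hst


/-- **`abc_of_S_v3` — the branch-C certificate with the Cor.-3.12 setting PINNED to the genuine print-normalised assembled real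
setting** (abc-iut-c312-7 `Real.settingPrVolSharp` over abc-iut-c312-5 `LatticeSituation.ofShells`, real log-shells of the datum's
field `F` with the analytic logarithm). `ABC` from TWO explicit hypotheses, each ∀-quantified as `Cor22.Thm110Legendre` binds
(`λ ∈ U_X` minimal, `l` prime `≥ 5`, «admits an `F`-core», (P2), (P5), (P6)): [S-bundle at the genuine setting] `H` — for every
genuine Θ-volume datum `T` at `(λ, l)` (abc-iut-S2; EXISTS: `ThetaPartII.stub_thetaData`) THERE ARE setting data (pilot data `X` OF
`T.D`, auxiliary field `M`, archimedean/(b)(c) data, column binders, lattice/Frobenioid/pilot context, ideles `t`, `tq`, PR-1's `ρ`,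
`qK`) such that the idele side conditions, the provenance (`IsPilotDataOf`, the index bijection), S, the two pins, Thm. 3.11
(ii)(b) at column `n` and the ONE-SIDED Θ-identification hold — i.e. the hypotheses of `cor312Of_of_S_genuine`, where `BridgeHyps`,
`ThetaFinite` and the `q`-number identity are THEOREMS; [CONE, layer S] `hvol` — the route's child (ii′) with print's `B_III(λ, l)`.
Downstream BY NAME and hypothesis-free: abc-iut-S2 `ABC_of_cor312_of_hullVolume_of_genEllTwo` (p424478) and abc-iut-S6
`genEllTwo_holds` (p422748). «`ABC` follows from S + these hypotheses as typed», nothing more; no side taken on [IUTchIII] Cor. 3.12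
or on any author; typed ≠ proved. [claim: Mochizuki2012, status: disputed] -/
theorem abc_of_S_v3
    (H : ∀ P₀ : NFPoint, P₀ ∈ UP → ∀ l : ℕ, l.Prime → 5 ≤ l →
      Cor22.AdmitsCore P₀ → Cor22.CondP2 P₀ l → Cor22.CondP5 P₀ l → Cor22.CondP6 P₀ l →
      ∀ T : Cor22.ThetaVolumeDatumAt P₀ l,
        letI := T.instFieldF; letI := T.instNumberFieldF; letI := T.instFieldK; letI := T.instNumberFieldK
        letI := T.instAlgebraK; letI := T.instFieldFbar; letI := T.instAlgebraFbar; letI := T.instAlgebraKFbar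
        letI := T.instIsElliptic
        ∃ (X : PilotData T.F) (M : Type) (_ : Field M) (_ : NumberField M)
          (archPk : ∀ (j : (thetaIndex X).Label) (vQ : (thetaIndex X).VQ), Set ((logShellsDH X (analyticLogv T.F)).Packet j vQ))
          (archSub : ∀ (j : (thetaIndex X).Label) (v : (thetaIndex X).V),
            Set ((logShellsDH X (analyticLogv T.F)).Packet j ((thetaIndex X).over v)))
          (Ψ : ℤ → ∀ v : (thetaIndex X).V, v ∈ (thetaIndex X).Vbad → Set ((logShellsDH X (analyticLogv T.F)).StarPacket v))
          (act : ℤ → ∀ v : (thetaIndex X).V, v ∈ (thetaIndex X).Vbad →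
            (logShellsDH X (analyticLogv T.F)).StarPacket v → Module.End ℚ ((logShellsDH X (analyticLogv T.F)).StarPacket v))
          (Mmod : ℤ → ∀ j : (thetaIndex X).LabelStar, Set ((logShellsDH X (analyticLogv T.F)).GlobalPacket j.1))
          (region : ℤ → ∀ j : (thetaIndex X).LabelStar, FinDivisor M → ∀ vQ : (thetaIndex X).VQ,
            Set ((logShellsDH X (analyticLogv T.F)).Packet j.1 vQ))
          (frobAdm : ℤ → ℤ → ∀ (j : (thetaIndex X).Label) (vQ : (thetaIndex X).VQ),
            Set ((logShellsDH X (analyticLogv T.F)).Packet j vQ) → Prop)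
          (frobLogvol : ℤ → ℤ → ∀ (j : (thetaIndex X).Label) (vQ : (thetaIndex X).VQ),
            Set ((logShellsDH X (analyticLogv T.F)).Packet j vQ) → ℝ)
          (frobΨ : ℤ → ℤ → ∀ v : (thetaIndex X).V, v ∈ (thetaIndex X).Vbad →
            Set ((logShellsDH X (analyticLogv T.F)).StarPacket v))
          (frobMmod : ℤ → ℤ → ∀ j : (thetaIndex X).LabelStar, Set ((logShellsDH X (analyticLogv T.F)).GlobalPacket j.1))
          (unitImage : ℤ → ℤ → ℕ → ∀ (j : (thetaIndex X).Label) (vQ : (thetaIndex X).VQ),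
            Set ((logShellsDH X (analyticLogv T.F)).Packet j vQ))
          (ballImage : ℤ → ℤ → ∀ (j : (thetaIndex X).Label) (vQ : (thetaIndex X).VQ),
            Set ((logShellsDH X (analyticLogv T.F)).Packet j vQ))
          (thetaDiv : ℤ → ℤ → LgpDivisor M (thetaIndex X).lstar)
          (n : ℤ) (HT : Type) (LogLink : HT → HT → Type) (IsFull : ∀ {s t : HT}, LogLink s t → Prop)
          (lat : LGPGaussianLogThetaLattice LogLink IsFull)
          (Frd : Type) (IsoF : Frd → Frd → Type) (Ob : Frd → Type) (realify : Frd → Frd) (Strip : Type)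
          (IsoS : Strip → Strip → Type) (Mv : ∀ v : (thetaIndex X).V, v ∈ (thetaIndex X).Vbad → Type)
          (_ : ∀ v h, Monoid (Mv v h))
          (sig : GlobalLGPFrobenioidSignature (thetaIndex X).lstar (thetaIndex X).V (· ∈ (thetaIndex X).Vbad)
            Frd IsoF Ob realify Strip IsoS Mv)
          (split : SplittingMonoids Mv) (ObΔ : Type) (N : ∀ v : (thetaIndex X).V, v ∈ (thetaIndex X).Vbad → Type)
          (_ : ∀ v h, Monoid (N v h)) (qData : QPilotData ObΔ N)
          (tq : ∀ (pp : Nat.Primes) (x : (thetaIndex X).Fibre (.inr pp)), haveI : Fact (pp : ℕ).Prime := ⟨pp.2⟩; kOf X pp.1 x)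
          (t : ∀ (pp : Nat.Primes) (_ : Fin X.lstar) (x : (thetaIndex X).Fibre (.inr pp)),
            haveI : Fact (pp : ℕ).Prime := ⟨pp.2⟩; kOf X pp.1 x)
          (ρ : (∀ v : (thetaIndex X).V, v ∈ (thetaIndex X).Vbad → Set ((logShellsDH X (analyticLogv T.F)).StarPacket v)) →
            ∀ (j : (thetaIndex X).Label) (vQ : (thetaIndex X).VQ), Set ((logShellsDH X (analyticLogv T.F)).Packet j vQ))
          (qK : ∀ v : (thetaIndex X).V, v ∈ (thetaIndex X).Vbad → Set ((logShellsDH X (analyticLogv T.F)).StarPacket v))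
          (htq0 : ∀ pp x, tq pp x ≠ 0)
          (htq1 : ∀ (pp : Nat.Primes) (x : (thetaIndex X).Fibre (.inr pp)),
            haveI : Fact (pp : ℕ).Prime := ⟨pp.2⟩; placeOf X pp.1 x ∉ X.S → ‖tq pp x‖ = 1)
          (_ : ∀ (pp : Nat.Primes) (x : (thetaIndex X).Fibre (.inr pp)),
            haveI : Fact (pp : ℕ).Prime := ⟨pp.2⟩
            Real.log ‖tq pp x‖ = -(X.qPilot (placeOf X pp.1 x)) * logNorm T.F (placeOf X pp.1 x) /
              localDegree T.F (placeOf X pp.1 x))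
          (_ : ∀ pp i x, t pp i x ≠ 0)
          (_ : ∀ (pp : Nat.Primes) (i : Fin X.lstar) (x : (thetaIndex X).Fibre (.inr pp)),
            haveI : Fact (pp : ℕ).Prime := ⟨pp.2⟩; placeOf X pp.1 x ∉ X.S → ‖t pp i x‖ = 1)
          (_ : IsPilotDataOf T.D X)
          (_ : ∃ e : (thetaIndex X).V ≃ T.D.V, ∀ v : (thetaIndex X).V,
            v ∈ (thetaIndex X).Vbad ↔ ((e v : T.D.V) : Val T.K) ∈ T.D.Vbad),
          Cor312Vol.PilotKummerCompatHull
              (LatticeSituation.ofShells (logShellsDH X (analyticLogv T.F)) M archPk archSub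
                (summandPiecesPr X (logvAnalytic_analyticLogv (F := T.F))).Adm
                (summandPiecesPr X (logvAnalytic_analyticLogv (F := T.F))).logvol Ψ act Mmod region
                frobAdm frobLogvol frobΨ frobMmod unitImage ballImage thetaDiv)
              (settingPrVolSharp X (logvAnalytic_analyticLogv (F := T.F)) M archPk archSub Ψ act Mmod region n lat sig split
                qData tq t htq0 htq1) ρ qK ∧
            Cor312Vol.QPinned
              (LatticeSituation.ofShells (logShellsDH X (analyticLogv T.F)) M archPk archSub
                (summandPiecesPr X (logvAnalytic_analyticLogv (F := T.F))).Adm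
                (summandPiecesPr X (logvAnalytic_analyticLogv (F := T.F))).logvol Ψ act Mmod region
                frobAdm frobLogvol frobΨ frobMmod unitImage ballImage thetaDiv)
              (settingPrVolSharp X (logvAnalytic_analyticLogv (F := T.F)) M archPk archSub Ψ act Mmod region n lat sig split
                qData tq t htq0 htq1) ρ qK ∧
            (settingPrVolSharp X (logvAnalytic_analyticLogv (F := T.F)) M archPk archSub Ψ act Mmod region n lat sig split qData
                tq t htq0 htq1).negLogTheta ≤ ((T.negLogTheta : ℝ) : WithTop ℝ))
    -- [CONE, layer S] the computable half (ii′) with print's B_III(λ, l)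
    (hvol : ∀ P₀ : NFPoint, P₀ ∈ UP → ∀ l : ℕ, l.Prime → 5 ≤ l →
      Cor22.AdmitsCore P₀ → Cor22.CondP2 P₀ l → Cor22.CondP5 P₀ l → Cor22.CondP6 P₀ l →
        Cor22.HullVolumeAtDatum P₀ l (((l : ℝ) + 1) / 4 *
          ((1 + 12 * (Cor22.dmod P₀ : ℝ) / l) * (P₀.logDiff + Cor22.logCondAvoid P₀ {2, l})
            + 2 * Real.log l + 52
            + 20 / 3 * Real.log (((2 ^ 12 * 3 ^ 3 * 5 * Cor22.dmod P₀ : ℕ) : ℝ) * (l : ℝ))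
              * (Nat.primeCounting (2 ^ 12 * 3 ^ 3 * 5 * Cor22.dmod P₀ * l) : ℝ)))) :
    _root_.ABC := by
  refine Summit.ABC.ABC.Theorems.ABC_of_cor312_of_hullVolume_of_genEllTwo (fun P₀ hP l hl h5 hc h2 h5' h6 => ?_) hvol
    Summit.ABC.ABC.Theorems.genEllTwo_holds
  intro T
  letI := T.instFieldF; letI := T.instNumberFieldF; letI := T.instFieldK; letI := T.instNumberFieldK
  letI := T.instAlgebraK; letI := T.instFieldFbar; letI := T.instAlgebraFbar; letI := T.instAlgebraKFbar
  letI := T.instIsElliptic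
  obtain ⟨X, M, _, _, archPk, archSub, Ψ, act, Mmod, region, frobAdm, frobLogvol, frobΨ, frobMmod, unitImage, ballImage,
    thetaDiv, n, HT, LogLink, IsFull, lat, Frd, IsoF, Ob, realify, Strip, IsoS, Mv, _, sig, split, ObΔ, N, _, qData, tq, t, ρ, qK,
    htq0, htq1, htq, ht0, ht1, hX, hplaces, hSH, hQPin, hΘ⟩ := H P₀ hP l hl h5 hc h2 h5' h6 T
  exact cor312Of_of_SH_genuine T.D T.I X M archPk archSub Ψ act Mmod region frobAdm frobLogvol frobΨ frobMmod unitImage ballImage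
    thetaDiv n lat sig split qData tq t ρ qK htq0 htq1 htq ht0 ht1 T.isVolumeInputOf hX hplaces hSH hQPin hΘ

end Summit.ABC.IUTFork.Conditional

end
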